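import Summits.ValiantsHypothesis.ValiantsHypothesis.Theorems.BarrierLeverChowBenchmarkPairsFirstOrderExpansion

/-!
# Route BarrierLever — item 22038 `ChowBenchmarkPairs`, line `moore-peel`: the FIRST-ORDER REDUCTION
# of the ∀h stub `stub_segmentMeanValue` (the newest point may be taken infinitesimal)

Helper file (`--supports stmt-ValiantsHypothesis-22038`; cell valiant-natproofs, rung V4, 𝒟-side
benchmark of record; seat valiant-natproofs-prover gen 15; MEMO-freenode-g15 §10 (a)).  Closes NO item;
definition-free.  Part 2 of 2 (part 1 = `…FirstOrderExpansion`: segment sums over a ring, the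
`ε`-expansions of the rows through the last point).

The segment-moment matrix of height `h+1` is `N[S,T] = Σ_{g : T → S} ∏_{c∈T} P_{g(c),c} ∏_{a∈S} |g⁻¹(a)|!`
(rows `S` = the sets of size `≤ 2`, columns `T` = the benchmark codes).  Put the LAST point on a ray
through the origin, `P_{last} = ε·Q`, and keep the other points `P_a`.  Subtracting from every row
`S ∋ last` its partner row `S ∖ {last}` (a unipotent row operation `1 − E`, `E² = 0`) makes those rows
divisible by `ε`, and the `ε¹`-coefficients are the FIRST-ORDER rows
`Σ_{c∈T} Q_c · N[S ∖ {last}, T ∖ {c}]` (the functionals `m ↦ E[(D_Q m)(Σ τ_a P_a)]`).  Hence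
`det N(ε) = det(1+E)⁻¹ · ε^{h+1} · det M̃(ε)` with `M̃(0) =` the first-order matrix, and

  **`segmentMeanValueAt_of_firstOrder`**: if for every enumeration of the rows SOME base table `Pb`
  and direction `Q` make the first-order matrix nonsingular, then `SegmentMeanValueAt (h+1)` (the line
  file's statement, unfolded verbatim) holds — a coordinate-free ∀h reduction in which the new point
  enters only LINEARLY (a matrix pencil in `Q`).  Numerically the first-order matrices are nonsingular
  for every `h ≤ 13` (MEMO-freenode-g15 §10, `lab/firstorder.py`).

WHAT THIS IS NOT: the first-order matrices are NOT shown nonsingular here; nothing on items 20172 /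
19717, crux stmt-ValiantsHypothesis-14610, or `VP` versus `VNP`.
-/

set_option linter.dupNamespace false

namespace Summit.ValiantsHypothesis.ValiantsHypothesis.Theorems.BarrierLever.ChowBenchmarkFirstOrder

open MvPolynomial Finset Polynomial
open Summit.ValiantsHypothesis.ValiantsHypothesis.Theorems.BarrierLever.MoorePeel (benchCols)

/-! ## 3. The first-order reduction -/

section Reduction

open Summit.ValiantsHypothesis.ValiantsHypothesis.Theorems.BarrierLever.MoorePeel
  (eq_empty_or_singleton_or_pair)

/-- In a set of size `≤ 2` containing `Fin.last h`: either `{last}` or `{a, last}` with `a ≠ last`. -/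
theorem eq_single_or_pair_of_last_mem {h : ℕ} (S : Finset (Fin (h + 1))) (hS : S.card ≤ 2)
    (hL : Fin.last h ∈ S) :
    S = {Fin.last h} ∨ ∃ a : Fin (h + 1), a ≠ Fin.last h ∧ S = {a, Fin.last h} := by
  rcases eq_empty_or_singleton_or_pair S hS with h0 | ⟨b, hb⟩ | ⟨b, b', hlt, hbb⟩
  · subst h0; simp at hL
  · subst hb
    rw [Finset.mem_singleton] at hL
    exact Or.inl (by rw [hL])
  · subst hbb
    right
    rcases Finset.mem_insert.mp hL with e | e
    · exact absurd (e ▸ hlt) (not_lt.mpr (Fin.le_last b'))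
    · rw [Finset.mem_singleton] at e
      exact ⟨b, by rw [e]; exact ne_of_lt hlt, by rw [e]⟩

/-- **THE FIRST-ORDER REDUCTION.**  Fix a height `h + 1`.  Suppose that for every injective
enumeration `u` of the subsets of `Fin (h+1)` of size `≤ 2` there are a base table `Pb` (its row
`Fin.last h` is never read) and a direction `Q` such that the FIRST-ORDER MATRIX — row `i` equal to
the segment row `segEntry Pb (u i) T_j` when `last ∉ u i`, and to the derivative row
`Σ_{c ∈ T_j} Q_c · segEntry Pb (u i ∖ {last}) (T_j ∖ {c})` when `last ∈ u i` — is nonsingular.  Then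
`SegmentMeanValueAt (h+1)` (the line file's statement, unfolded verbatim): some point table makes the
segment-moment matrix of the benchmark layout nonsingular (namely `P_last = ε·Q`, `P_a = Pb_a`, for a
suitable `ε ≠ 0`). -/
theorem segmentMeanValueAt_of_firstOrder (h : ℕ)
    (hFO : ∀ (r : ℕ) (u : Fin r → Finset (Fin (h + 1))), Function.Injective u →
      (∀ i, (u i).card ≤ 2) → (∀ S : Finset (Fin (h + 1)), S.card ≤ 2 → ∃ i, u i = S) →
      ∃ (Pb : Fin (h + 1) → Fin (h + 1) → ℂ) (Q : Fin (h + 1) → ℂ),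
        (Matrix.of fun i j : Fin r =>
          if Fin.last h ∈ u i then
            ∑ c ∈ benchCols (h + 1) r j, Q c *
              ∑ g : (↥((benchCols (h + 1) r j).erase c) → ↥((u i).erase (Fin.last h))),
                (∏ c' : ↥((benchCols (h + 1) r j).erase c), Pb (g c') c') *
                ∏ a : ↥((u i).erase (Fin.last h)),
                  ((Finset.univ.filter fun c' : ↥((benchCols (h + 1) r j).erase c) =>
                    g c' = a).card.factorial : ℂ)
          else
            ∑ g : (↥(benchCols (h + 1) r j) → ↥(u i)),
              (∏ c : ↥(benchCols (h + 1) r j), Pb (g c) c) *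
              ∏ a : ↥(u i), ((Finset.univ.filter fun c : ↥(benchCols (h + 1) r j) =>
                g c = a).card.factorial : ℂ)).det ≠ 0) :
    ∀ (r : ℕ) (u : Fin r → Finset (Fin (h + 1))), Function.Injective u →
      (∀ i, (u i).card ≤ 2) → (∀ S : Finset (Fin (h + 1)), S.card ≤ 2 → ∃ i, u i = S) →
      ∃ P : Fin (h + 1) → Fin (h + 1) → ℂ,
        (Matrix.of fun i j : Fin r =>
          ∑ g : (↥(benchCols (h + 1) r j) → ↥(u i)),
            (∏ c : ↥(benchCols (h + 1) r j), P (g c) c) *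
            ∏ a : ↥(u i), ((Finset.univ.filter fun c : ↥(benchCols (h + 1) r j) =>
              g c = a).card.factorial : ℂ)).det ≠ 0 := by
  classical
  intro r u hu hcard hsurj
  obtain ⟨Pb, Q, hdet⟩ := hFO r u hu hcard hsurj
  -- the polynomial table: last point `X • Q`, other points constant
  let P' : Fin (h + 1) → Fin (h + 1) → ℂ[X] := fun a c =>
    if a = Fin.last h then Polynomial.X * Polynomial.C (Q c) else Polynomial.C (Pb a c)
  have hlast : ∀ c, P' (Fin.last h) c = Polynomial.X * Polynomial.C (Q c) := fun c => by simp [P']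
  have hother : ∀ a, a ≠ Fin.last h → ∀ c, P' a c = Polynomial.C (Pb a c) :=
    fun a ha c => by simp [P', ha]
  -- the matrix over `ℂ[X]`
  let N' : Matrix (Fin r) (Fin r) ℂ[X] := Matrix.of fun i j =>
    ∑ g : (↥(benchCols (h + 1) r j) → ↥(u i)), (∏ c : ↥(benchCols (h + 1) r j), P' (g c) c) *
      ∏ a : ↥(u i), ((Finset.univ.filter fun c : ↥(benchCols (h + 1) r j) => g c = a).card.factorial
        : ℂ[X])
  -- partner of a row through the last point: the row `u i ∖ {last}`
  have hpart : ∀ i, ∃ i', u i' = (u i).erase (Fin.last h) := fun i =>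
    hsurj _ ((Finset.card_erase_le).trans (hcard i))
  let π : Fin r → Fin r := fun i => Classical.choose (hpart i)
  have hπ : ∀ i, u (π i) = (u i).erase (Fin.last h) := fun i => Classical.choose_spec (hpart i)
  have hπL : ∀ i, Fin.last h ∉ u (π i) := fun i => by
    rw [hπ]; exact Finset.notMem_erase (Fin.last h) _
  -- `{a, last} ∖ {last} = {a}`
  have herase : ∀ a : Fin (h + 1), a ≠ Fin.last h →
      ({a, Fin.last h} : Finset (Fin (h + 1))).erase (Fin.last h) = {a} := by
    intro a ha
    ext x
    simp only [Finset.mem_erase, Finset.mem_insert, Finset.mem_singleton]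
    constructor
    · rintro ⟨hx, hx' | hx'⟩
      · exact hx'
      · exact absurd hx' hx
    · intro hx
      rw [hx]
      exact ⟨ha, Or.inl rfl⟩
  -- the unipotent row operation
  let E : Matrix (Fin r) (Fin r) ℂ[X] :=
    Matrix.of fun i j => if Fin.last h ∈ u i ∧ j = π i then 1 else 0
  have hEE : E * E = 0 := by
    apply Matrix.ext
    intro i j
    rw [Matrix.mul_apply, Matrix.zero_apply]
    refine Finset.sum_eq_zero fun m _ => ?_
    simp only [E, Matrix.of_apply]
    by_cases h1 : Fin.last h ∈ u i ∧ m = π i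
    · rw [if_pos h1, if_neg, mul_zero]
      rintro ⟨hm, -⟩
      exact hπL i (h1.2 ▸ hm)
    · rw [if_neg h1, zero_mul]
  have hunit : (1 - E).det * (1 + E).det = 1 := by
    rw [← Matrix.det_mul, mul_add, mul_one, sub_mul, one_mul, hEE, sub_zero, sub_add_cancel,
      Matrix.det_one]
  let N'' : Matrix (Fin r) (Fin r) ℂ[X] := (1 - E) * N'
  have hN'' : ∀ i j, N'' i j = N' i j - if Fin.last h ∈ u i then N' (π i) j else 0 := by
    intro i j
    simp only [N'', Matrix.sub_mul, Matrix.one_mul, Matrix.sub_apply, Matrix.mul_apply, E,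
      Matrix.of_apply]
    congr 1
    by_cases hLi : Fin.last h ∈ u i
    · rw [if_pos hLi, Finset.sum_eq_single (π i)]
      · rw [if_pos ⟨hLi, rfl⟩, one_mul]
      · intro m _ hm
        rw [if_neg (fun hc => hm hc.2), zero_mul]
      · intro hni
        exact absurd (Finset.mem_univ _) hni
    · rw [if_neg hLi]
      exact Finset.sum_eq_zero fun m _ => by rw [if_neg (fun hc => hLi hc.1), zero_mul]
  -- the two shapes of a row through the last point, and its partner
  have hshape : ∀ i, Fin.last h ∈ u i →
      (u i = {Fin.last h} ∧ u (π i) = ∅) ∨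
      ∃ a : Fin (h + 1), a ≠ Fin.last h ∧ u i = {a, Fin.last h} ∧ u (π i) = {a} := by
    intro i hLi
    rcases eq_single_or_pair_of_last_mem (u i) (hcard i) hLi with hs | ⟨a, ha, hs⟩
    · exact Or.inl ⟨hs, by rw [hπ, hs, Finset.erase_singleton]⟩
    · exact Or.inr ⟨a, ha, hs, by rw [hπ, hs, herase a ha]⟩
  -- the rows through the last point vanish at `X = 0`
  have hcoeff0 : ∀ i j, Fin.last h ∈ u i → (N'' i j).coeff 0 = 0 := by
    intro i j hLi
    rw [hN'' i j, if_pos hLi]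
    simp only [N', Matrix.of_apply]
    rcases hshape i hLi with ⟨hs, hπi⟩ | ⟨a, ha, hs, hπi⟩
    · rw [hs, hπi]
      exact coeff_zero_sub_partner_single P' Q hlast _
    · rw [hs, hπi]
      exact coeff_zero_sub_partner_pair P' Pb Q a ha hlast (hother a ha) _
  -- pull `X` out of those rows
  let v : Fin r → ℂ[X] := fun i => if Fin.last h ∈ u i then Polynomial.X else 1
  let Mt : Matrix (Fin r) (Fin r) ℂ[X] := Matrix.of fun i j =>
    if Fin.last h ∈ u i then (N'' i j).divX else N'' i j
  have hfactor : N'' = Matrix.of fun i j => v i * Mt i j := by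
    apply Matrix.ext
    intro i j
    simp only [Matrix.of_apply, v, Mt]
    by_cases hLi : Fin.last h ∈ u i
    · rw [if_pos hLi, if_pos hLi]
      have e := Polynomial.X_mul_divX_add (N'' i j)
      rw [hcoeff0 i j hLi, map_zero, add_zero] at e
      exact e.symm
    · rw [if_neg hLi, if_neg hLi, one_mul]
  have hdetN'' : N''.det = (∏ i, v i) * Mt.det := by rw [hfactor, Matrix.det_mul_column]
  -- at `X = 0` the matrix `Mt` is the first-order matrix
  have heval0 : (Polynomial.evalRingHom (0 : ℂ)).mapMatrix Mt = Matrix.of fun i j : Fin r =>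
      if Fin.last h ∈ u i then
        ∑ c ∈ benchCols (h + 1) r j, Q c *
          ∑ g : (↥((benchCols (h + 1) r j).erase c) → ↥((u i).erase (Fin.last h))),
            (∏ c' : ↥((benchCols (h + 1) r j).erase c), Pb (g c') c') *
            ∏ a : ↥((u i).erase (Fin.last h)),
              ((Finset.univ.filter fun c' : ↥((benchCols (h + 1) r j).erase c) =>
                g c' = a).card.factorial : ℂ)
      else
        ∑ g : (↥(benchCols (h + 1) r j) → ↥(u i)),
          (∏ c : ↥(benchCols (h + 1) r j), Pb (g c) c) *
          ∏ a : ↥(u i), ((Finset.univ.filter fun c : ↥(benchCols (h + 1) r j) =>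
            g c = a).card.factorial : ℂ) := by
    apply Matrix.ext
    intro i j
    rw [RingHom.mapMatrix_apply, Matrix.map_apply, Matrix.of_apply]
    simp only [Mt, Matrix.of_apply, Polynomial.coe_evalRingHom]
    by_cases hLi : Fin.last h ∈ u i
    · rw [if_pos hLi, if_pos hLi, ← Polynomial.coeff_zero_eq_eval_zero, Polynomial.coeff_divX,
        zero_add, hN'' i j, if_pos hLi]
      simp only [N', Matrix.of_apply]
      rcases hshape i hLi with ⟨hs, hπi⟩ | ⟨a, ha, hs, hπi⟩
      · rw [hs, hπi, Finset.erase_singleton]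
        exact coeff_one_sub_partner_single P' Pb Q hlast _
      · rw [hs, hπi, herase a ha]
        exact coeff_one_sub_partner_pair P' Pb Q a ha hlast (hother a ha) _
    · rw [if_neg hLi, if_neg hLi, hN'' i j, if_neg hLi, sub_zero]
      simp only [N', Matrix.of_apply]
      have e1 := map_segSum (Polynomial.evalRingHom (0 : ℂ)) P' (u i) (benchCols (h + 1) r j)
      simp only [Polynomial.coe_evalRingHom] at e1
      rw [e1]
      refine segSum_congr (fun a c => Polynomial.eval 0 (P' a c)) Pb (u i) (benchCols (h + 1) r j)
        fun a ha' c _ => ?_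
      have hne : a ≠ Fin.last h := fun e => hLi (by rw [← e]; exact ha')
      show Polynomial.eval 0 (P' a c) = Pb a c
      rw [hother a hne c, Polynomial.eval_C]
  have hMt : Mt.det ≠ 0 := by
    intro h0
    apply hdet
    have e := RingHom.map_det (Polynomial.evalRingHom (0 : ℂ)) Mt
    rw [h0, map_zero, heval0] at e
    exact e.symm
  -- a nonzero `ε` at which `det Mt` does not vanish
  have hXM : Polynomial.X * Mt.det ≠ 0 := mul_ne_zero Polynomial.X_ne_zero hMt
  obtain ⟨ε, hε⟩ := Infinite.exists_notMem_finset ((Polynomial.X * Mt.det).roots.toFinset)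
  rw [Multiset.mem_toFinset, Polynomial.mem_roots hXM, Polynomial.IsRoot.def, Polynomial.eval_mul,
    Polynomial.eval_X, mul_eq_zero, not_or] at hε
  obtain ⟨hε0, hεM⟩ := hε
  -- the witness table
  refine ⟨fun a c => (P' a c).eval ε, ?_⟩
  have hmat : (Matrix.of fun i j : Fin r =>
      ∑ g : (↥(benchCols (h + 1) r j) → ↥(u i)),
        (∏ c : ↥(benchCols (h + 1) r j), (P' (g c) c).eval ε) *
        ∏ a : ↥(u i), ((Finset.univ.filter fun c : ↥(benchCols (h + 1) r j) =>
          g c = a).card.factorial : ℂ)) = (Polynomial.evalRingHom ε).mapMatrix N' := by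
    apply Matrix.ext
    intro i j
    rw [RingHom.mapMatrix_apply, Matrix.map_apply, Matrix.of_apply]
    simp only [N', Matrix.of_apply]
    rw [map_segSum]
    simp only [Polynomial.coe_evalRingHom]
  rw [hmat, ← RingHom.map_det]
  -- `det N' = det (1 + E) · det N''` and everything is nonzero at `ε`
  have hN'det : N'.det = (1 + E).det * N''.det := by
    simp only [N'']
    rw [Matrix.det_mul, ← mul_assoc, mul_comm (1 + E).det, hunit, one_mul]
  rw [hN'det, hdetN'', map_mul, map_mul]
  refine mul_ne_zero ?_ (mul_ne_zero ?_ ?_)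
  · intro h0
    have e := congrArg (Polynomial.evalRingHom ε) hunit
    rw [map_mul, h0, mul_zero, map_one] at e
    exact zero_ne_one e
  · rw [Polynomial.coe_evalRingHom, Polynomial.eval_prod]
    refine Finset.prod_ne_zero_iff.mpr fun i _ => ?_
    simp only [v]
    by_cases hLi : Fin.last h ∈ u i
    · rw [if_pos hLi, Polynomial.eval_X]; exact hε0
    · rw [if_neg hLi, Polynomial.eval_one]; exact one_ne_zero
  · exact hεM

end Reduction

end Summit.ValiantsHypothesis.ValiantsHypothesis.Theorems.BarrierLever.ChowBenchmarkFirstOrder
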